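import Literature.Analysis.TotalPositivity.PolyaFrequencyFunctions
import Mathlib.Analysis.Convolution
import Mathlib.MeasureTheory.Measure.Haar.Unique
import Mathlib.MeasureTheory.Integral.Pi
import Mathlib.Data.Fin.Tuple.Sort
import HarnessLib

/-!
# Pólya frequency functions: the basic composition formula and closure under convolution
(Schoenberg 1951, Lemma 1)

Trunk `Literature/Analysis/TotalPositivity`, second proofs file accompanying
`PolyaFrequencyFunctions.lean` (the named fact `schoenberg1951_pf_laplace`), continuing the
bottom-up formalisation of the sufficiency half of Schoenberg's theorem.  Here: "the convolution
of Pólya frequency functions again leads to such functions" [SchoenbergWhitney1953, Introduction,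
p. 247, quoting Schoenberg 1951], via the **basic composition formula** (Pólya–Szegő; Karlin's
"basic composition formula", [Karlin1968, Ch. 1, (2.5) and Ch. 7, §1]): if
`h(u) = ∫ f(t) g(u − t) dt` then
`n! · det ‖h(x_i − y_j)‖ = ∫_{ℝⁿ} det ‖f(x_i − s_j)‖ · det ‖g(s_i − y_j)‖ ds`,
and the integrand is pointwise `≥ 0` when `f, g` are Pólya frequency functions (sort `s`; both
determinants pick up the same sign).  Consequences: `IsPolyaFrequencyFun.conv` (with one factor
bounded, so that the convolution integral converges everywhere — total positivity is a pointwise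
condition), the bound `(f ⋆ g) ≤ (sup g) ∫ f`, and the multiplicativity of the Laplace transform
`HasLaplaceTransformInvOn.conv` (Fubini, [SchoenbergWhitney1953, (6)]).

## Main results

* `factorial_mul_translationMinor_conv` — the basic composition formula.
* `translationMinor_mul_nonneg` — pointwise non-negativity of the integrand.
* `IsPolyaFrequencyFun.conv` — Schoenberg 1951, Lemma 1: `f ⋆ g` is a Pólya frequency function.
* `HasLaplaceTransformInvOn.conv` — the reciprocal transforms multiply on the common strip.

## References

* I. J. Schoenberg, *On Pólya frequency functions. I*, J. Analyse Math. 1 (1951) 331–374,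
  Lemma 1 (convolutions of totally positive functions). [Schoenberg1951]
* I. J. Schoenberg, A. Whitney, *On Pólya frequency functions. III*, Trans. AMS 74 (1953)
  246–259, Introduction p. 247. [SchoenbergWhitney1953]
* S. Karlin, *Total Positivity* I (1968), Ch. 1 §2 (basic composition formula), Ch. 7 §1.
  [Karlin1968]
* G. Pólya, G. Szegő, *Problems and Theorems in Analysis* I, Part II, Problem 68
  (composition of kernels). [folklore]
-/

noncomputable section

open MeasureTheory Set
open scoped Topology

namespace Literature.Analysis.TotalPositivity

/-! ### Permutations of the nodes -/

section Perm

variable {n : ℕ}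

/-- The Lebesgue integral on `ℝⁿ` is invariant under permutations of the coordinates. [folklore] -/
theorem integral_comp_perm (τ : Equiv.Perm (Fin n)) (Φ : (Fin n → ℝ) → ℝ) :
    ∫ S : Fin n → ℝ, Φ (fun i => S (τ i)) = ∫ S : Fin n → ℝ, Φ S := by
  have h := (volume_measurePreserving_piCongrLeft (fun _ : Fin n => ℝ) τ.symm).integral_comp' Φ
  refine Eq.trans ?_ h
  congr 1
  funext S
  congr 1
  funext i
  simp only [MeasurableEquiv.coe_piCongrLeft, Equiv.piCongrLeft_apply_eq_cast, cast_eq,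
    Equiv.symm_symm]

/-- Permuting the second node set multiplies a translation determinant by the signature.
[folklore] -/
theorem translationMinor_perm_right (f : ℝ → ℝ) (x S : Fin n → ℝ) (τ : Equiv.Perm (Fin n)) :
    translationMinor f x (fun j => S (τ j)) =
      ((Equiv.Perm.sign τ : ℤ) : ℝ) * translationMinor f x S := by
  unfold translationMinor
  rw [← Matrix.det_permute' τ]
  rfl

/-- Permuting the first node set multiplies a translation determinant by the signature.
[folklore] -/
theorem translationMinor_perm_left (g : ℝ → ℝ) (S y : Fin n → ℝ) (τ : Equiv.Perm (Fin n)) :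
    translationMinor g (fun i => S (τ i)) y =
      ((Equiv.Perm.sign τ : ℤ) : ℝ) * translationMinor g S y := by
  unfold translationMinor
  rw [← Matrix.det_permute τ]
  rfl

/-- A translation determinant with a repeated node vanishes. [folklore] -/
theorem translationMinor_eq_zero_of_not_injective (f : ℝ → ℝ) (x S : Fin n → ℝ)
    (hS : ¬ Function.Injective S) : translationMinor f x S = 0 := by
  unfold translationMinor
  simp only [Function.Injective, not_forall] at hS
  obtain ⟨i, j, hij, hne⟩ := hS
  exact Matrix.det_zero_of_column_eq hne fun k => by simp [hij]

/-- **Pointwise non-negativity of the composition integrand.**  For Pólya frequency functions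
`f, g` and increasing `x, y`, `det ‖f(x_i − s_j)‖ · det ‖g(s_i − y_j)‖ ≥ 0` for EVERY `s ∈ ℝⁿ`:
if two `s_j` coincide the first factor vanishes; otherwise sorting `s` multiplies both factors by
the same sign. [cite: Karlin1968, Ch. 7 §1] [folklore] -/
theorem translationMinor_mul_nonneg {f g : ℝ → ℝ} (hf : IsPolyaFrequencyFun f)
    (hg : IsPolyaFrequencyFun g) {x y : Fin n → ℝ} (hx : StrictMono x) (hy : StrictMono y)
    (S : Fin n → ℝ) : 0 ≤ translationMinor f x S * translationMinor g S y := by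
  by_cases hS : Function.Injective S
  · set σ := Tuple.sort S with hσ
    have hmono : StrictMono (fun i => S (σ i)) :=
      (Tuple.monotone_sort S).strictMono_of_injective (hS.comp σ.injective)
    have h1 := translationMinor_perm_right f x S σ
    have h2 := translationMinor_perm_left g S y σ
    have hprod : translationMinor f x S * translationMinor g S y =
        translationMinor f x (fun j => S (σ j)) * translationMinor g (fun i => S (σ i)) y := by
      rw [h1, h2]
      rcases Int.units_eq_one_or (Equiv.Perm.sign σ) with h | h <;> simp [h]
    rw [hprod]
    exact mul_nonneg (hf.2.2.2.2 n x _ hx hmono) (hg.2.2.2.2 n _ y hmono hy)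
  · rw [translationMinor_eq_zero_of_not_injective f x S hS, zero_mul]

end Perm

/-! ### The basic composition formula -/

section Composition

variable {n : ℕ}

/-- **Basic composition formula** (Pólya–Szegő; Karlin): if `f` is integrable and `g` is bounded
and measurable, then for `h(u) = ∫ f(t) g(u − t) dt` and any nodes `x, y : Fin n → ℝ`,
`n! · det ‖h(x_i − y_j)‖ = ∫_{ℝⁿ} det ‖f(x_i − s_j)‖ det ‖g(s_i − y_j)‖ ds`.
Proof: expand `det ‖h‖` over permutations, write each product of `n` integrals as an integral
over `ℝⁿ` (Fubini), recognise `det ‖f(x_i − s_j)‖ ∏ g(s_i − y_i)` under the integral, and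
average over the `n!` relabellings of `s`. [cite: Karlin1968, Ch. 1 (2.5); Ch. 7 §1] -/
theorem factorial_mul_translationMinor_conv (f g : ℝ → ℝ) (hf : Integrable f)
    (hgm : Measurable g) {C : ℝ} (hgb : ∀ u, |g u| ≤ C) (x y : Fin n → ℝ) :
    (Nat.factorial n : ℝ) * translationMinor (fun u => ∫ t, f t * g (u - t)) x y =
      ∫ S : Fin n → ℝ, translationMinor f x S * translationMinor g S y := by
  classical
  -- the entries in kernel form
  have hent : ∀ i j : Fin n, (∫ t, f t * g (x i - y j - t)) = ∫ s, f (x i - s) * g (s - y j) := by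
    intro i j
    rw [← integral_sub_left_eq_self (fun t => f t * g (x i - y j - t)) volume (x i)]
    congr 1
    funext s
    congr 2
    ring
  -- integrability of the elementary products
  have hI : ∀ i j : Fin n, Integrable (fun s => f (x i - s) * g (s - y j)) := fun i j =>
    (hf.comp_sub_left (x i)).mul_bdd (hgm.comp (measurable_sub_const _)).aestronglyMeasurable
      (Filter.Eventually.of_forall fun s => by
        rw [Real.norm_eq_abs]
        exact hgb (s - y j))
  have hIprod : ∀ σ ρ : Equiv.Perm (Fin n),
      Integrable (fun S : Fin n → ℝ => ∏ i, f (x (σ i) - S i) * g (S i - y (ρ i))) := fun σ ρ =>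
    Integrable.fintype_prod (f := fun i s => f (x (σ i) - s) * g (s - y (ρ i))) fun i => hI (σ i) (ρ i)
  -- Step 1: `det ‖h‖ = ∫ det ‖f(x_i − s_j)‖ ∏ g(s_i − y_i) ds`
  have hdet : translationMinor (fun u => ∫ t, f t * g (u - t)) x y =
      ∫ S : Fin n → ℝ, translationMinor f x S * ∏ i, g (S i - y i) := by
    unfold translationMinor
    rw [Matrix.det_apply']
    simp only [Matrix.of_apply, hent]
    have hprod : ∀ σ : Equiv.Perm (Fin n), (∏ i, ∫ s, f (x (σ i) - s) * g (s - y i)) =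
        ∫ S : Fin n → ℝ, ∏ i, f (x (σ i) - S i) * g (S i - y i) := fun σ =>
      (integral_fintype_prod_volume_eq_prod (fun i s => f (x (σ i) - s) * g (s - y i))).symm
    simp only [hprod, ← integral_const_mul]
    rw [← integral_finsetSum _ (fun σ _ =>
      (Integrable.fintype_prod (f := fun i s => f (x (σ i) - s) * g (s - y i))
        fun i => hI (σ i) i).const_mul _)]
    congr 1
    funext S
    rw [Matrix.det_apply', Finset.sum_mul]
    refine Finset.sum_congr rfl fun σ _ => ?_
    simp only [Matrix.of_apply, Finset.prod_mul_distrib]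
    ring
  -- Step 2: relabelling `s ↦ s ∘ τ`
  have hsym : ∀ τ : Equiv.Perm (Fin n),
      (∫ S : Fin n → ℝ, translationMinor f x S * ∏ i, g (S i - y i)) =
        ((Equiv.Perm.sign τ : ℤ) : ℝ) *
          ∫ S : Fin n → ℝ, translationMinor f x S * ∏ i, g (S (τ i) - y i) := by
    intro τ
    rw [← integral_comp_perm τ (fun S => translationMinor f x S * ∏ i, g (S i - y i)),
      ← integral_const_mul]
    congr 1
    funext S
    simp only [translationMinor_perm_right]
    ring
  -- integrability of the relabelled integrands
  have hIsym : ∀ τ : Equiv.Perm (Fin n),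
      Integrable (fun S : Fin n → ℝ => translationMinor f x S * ∏ i, g (S (τ i) - y i)) := by
    intro τ
    have heq : (fun S : Fin n → ℝ => translationMinor f x S * ∏ i, g (S (τ i) - y i)) =
        fun S => ∑ σ : Equiv.Perm (Fin n), ((Equiv.Perm.sign σ : ℤ) : ℝ) *
          ∏ i, f (x (σ i) - S i) * g (S i - y (τ.symm i)) := by
      funext S
      unfold translationMinor
      rw [Matrix.det_apply', Finset.sum_mul]
      refine Finset.sum_congr rfl fun σ _ => ?_
      have hre : (∏ i, g (S (τ i) - y i)) = ∏ i, g (S i - y (τ.symm i)) :=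
        Fintype.prod_equiv τ _ _ fun i => by simp
      simp only [Matrix.of_apply, hre, Finset.prod_mul_distrib]
      ring
    rw [heq]
    exact integrable_finsetSum _ fun σ _ => (hIprod σ τ.symm).const_mul _
  -- Step 3: average over `τ`
  calc (Nat.factorial n : ℝ) * translationMinor (fun u => ∫ t, f t * g (u - t)) x y
      = ∑ _τ : Equiv.Perm (Fin n), translationMinor (fun u => ∫ t, f t * g (u - t)) x y := by
        rw [Finset.sum_const, Finset.card_univ, Fintype.card_perm, Fintype.card_fin, nsmul_eq_mul]
    _ = ∑ τ : Equiv.Perm (Fin n), ((Equiv.Perm.sign τ : ℤ) : ℝ) *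
          ∫ S : Fin n → ℝ, translationMinor f x S * ∏ i, g (S (τ i) - y i) := by
        refine Finset.sum_congr rfl fun τ _ => ?_
        rw [hdet, hsym τ]
    _ = ∫ S : Fin n → ℝ, ∑ τ : Equiv.Perm (Fin n), ((Equiv.Perm.sign τ : ℤ) : ℝ) *
          (translationMinor f x S * ∏ i, g (S (τ i) - y i)) := by
        rw [integral_finsetSum _ (fun τ _ => (hIsym τ).const_mul _)]
        simp only [integral_const_mul]
    _ = ∫ S : Fin n → ℝ, translationMinor f x S * translationMinor g S y := by
        congr 1
        funext S
        conv_rhs => rw [translationMinor, translationMinor, Matrix.det_apply' (Matrix.of fun i j => g (S i - y j))]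
        rw [Finset.mul_sum]
        refine Finset.sum_congr rfl fun τ _ => ?_
        simp only [Matrix.of_apply, translationMinor]
        ring

/-- **The convolution of two Pólya frequency functions is a Pólya frequency function**
(Schoenberg 1951, Lemma 1; quoted in Schoenberg–Whitney 1953, p. 247), for `g` bounded — so that
`h(u) = ∫ f(t) g(u − t) dt` converges for every `u` (total positivity is a pointwise condition;
all Pólya frequency functions are in fact bounded).  Non-negativity of the minors is the basic
composition formula with its pointwise non-negative integrand; measurability, integrability and
`∫ h = (∫ f)(∫ g) > 0` are Fubini. [cite: Schoenberg1951, Lemma 1]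
[cite: SchoenbergWhitney1953, Introduction p. 247] -/
theorem IsPolyaFrequencyFun.conv {f g : ℝ → ℝ} (hf : IsPolyaFrequencyFun f)
    (hg : IsPolyaFrequencyFun g) {C : ℝ} (hgb : ∀ u, g u ≤ C) :
    IsPolyaFrequencyFun fun u => ∫ t, f t * g (u - t) := by
  have hgb' : ∀ u, |g u| ≤ C := fun u => by
    rw [abs_of_nonneg (hg.1 u)]
    exact hgb u
  have hconv : (fun u => ∫ t, f t * g (u - t)) =
      MeasureTheory.convolution f g (ContinuousLinearMap.mul ℝ ℝ) volume := by
    funext u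
    rw [MeasureTheory.convolution_def]
    simp only [ContinuousLinearMap.mul_apply']
  refine ⟨?_, ?_, ?_, ?_, ?_⟩
  · exact fun u => integral_nonneg fun t => mul_nonneg (hf.1 t) (hg.1 _)
  · have hF : StronglyMeasurable (Function.uncurry fun (u t : ℝ) => f t * g (u - t)) :=
      ((hf.2.1.comp measurable_snd).mul (hg.2.1.comp (measurable_fst.sub measurable_snd)))
        |>.stronglyMeasurable
    exact (hF.integral_prod_right (ν := volume)).measurable
  · rw [hconv]
    exact hf.2.2.1.integrable_convolution (ContinuousLinearMap.mul ℝ ℝ) hg.2.2.1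
  · rw [hconv, MeasureTheory.integral_convolution (ContinuousLinearMap.mul ℝ ℝ) hf.2.2.1 hg.2.2.1,
      ContinuousLinearMap.mul_apply']
    exact mul_pos hf.2.2.2.1 hg.2.2.2.1
  · intro n x y hx hy
    have hmain := factorial_mul_translationMinor_conv f g hf.2.2.1 hg.2.1 hgb' x y
    have hpos : 0 ≤ ∫ S : Fin n → ℝ, translationMinor f x S * translationMinor g S y :=
      integral_nonneg fun S => translationMinor_mul_nonneg hf hg hx hy S
    rw [← hmain] at hpos
    exact (mul_nonneg_iff_of_pos_left (by positivity)).1 hpos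

/-- The convolution with a bounded non-negative `g ≤ C` is bounded by `C ∫ f`. [folklore] -/
theorem conv_le_of_le {f g : ℝ → ℝ} (hf : IsPolyaFrequencyFun f) (hg0 : ∀ u, 0 ≤ g u) {C : ℝ}
    (hgb : ∀ u, g u ≤ C) (u : ℝ) : ∫ t, f t * g (u - t) ≤ C * ∫ t, f t := by
  rw [← integral_const_mul]
  by_cases hi : Integrable (fun t => f t * g (u - t))
  · exact integral_mono hi (hf.2.2.1.const_mul C) fun t => by
      have h1 := hgb (u - t)
      have h2 := hf.1 t
      simpa [mul_comm] using mul_le_mul_of_nonneg_left h1 h2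
  · rw [integral_undef hi]
    have hC : 0 ≤ C := (hg0 0).trans (hgb 0)
    exact integral_nonneg fun t => mul_nonneg hC (hf.1 t)

/-- The convolution of non-negative functions is non-negative. [folklore] -/
theorem conv_nonneg {f g : ℝ → ℝ} (hf0 : ∀ u, 0 ≤ f u) (hg0 : ∀ u, 0 ≤ g u) (u : ℝ) :
    0 ≤ ∫ t, f t * g (u - t) :=
  integral_nonneg fun t => mul_nonneg (hf0 t) (hg0 _)

end Composition

/-! ### The Laplace transform of a convolution -/

/-- **The reciprocal Laplace transforms multiply under convolution** (Schoenberg–Whitney (6),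
"the convolution … leads to" the product of the factors of (7)): if on the strip `a < Re s < b`
the transforms of `f` and `g` converge absolutely to `1/Ψ₁`, `1/Ψ₂`, then the transform of
`h(u) = ∫ f(t) g(u − t) dt` converges absolutely there to `1/(Ψ₁Ψ₂)`.  Fubini
(`MeasureTheory.integral_convolution`) applied to `e^{−ts}f(t)` and `e^{−ts}g(t)`, whose
convolution is `e^{−us}h(u)`. [cite: SchoenbergWhitney1953, Introduction (5)–(7)] [folklore] -/
theorem HasLaplaceTransformInvOn.conv {f g : ℝ → ℝ} {Ψ₁ Ψ₂ : ℂ → ℂ} {a b : ℝ}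
    (hf : HasLaplaceTransformInvOn f Ψ₁ a b) (hg : HasLaplaceTransformInvOn g Ψ₂ a b) :
    HasLaplaceTransformInvOn (fun u => ∫ t, f t * g (u - t)) (fun s => Ψ₁ s * Ψ₂ s) a b := by
  intro s hs1 hs2
  obtain ⟨hfi, hf0, hfe⟩ := hf s hs1 hs2
  obtain ⟨hgi, hg0, hge⟩ := hg s hs1 hs2
  set F : ℝ → ℂ := fun x => Complex.exp (-(x : ℂ) * s) * (f x : ℂ) with hF
  set G : ℝ → ℂ := fun x => Complex.exp (-(x : ℂ) * s) * (g x : ℂ) with hG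
  have hkey : MeasureTheory.convolution F G (ContinuousLinearMap.mul ℂ ℂ) volume =
      fun x : ℝ => Complex.exp (-(x : ℂ) * s) * ((∫ t, f t * g (x - t) : ℝ) : ℂ) := by
    funext x
    rw [MeasureTheory.convolution_def]
    simp only [ContinuousLinearMap.mul_apply', hF, hG]
    rw [← integral_complex_ofReal, ← integral_const_mul]
    congr 1
    funext t
    push_cast
    have hexp : Complex.exp (-(x : ℂ) * s) =
        Complex.exp (-(t : ℂ) * s) * Complex.exp (-((x : ℂ) - t) * s) := by
      rw [← Complex.exp_add]
      congr 1
      ring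
    rw [hexp]
    ring
  refine ⟨?_, mul_ne_zero hf0 hg0, ?_⟩
  · rw [← hkey]
    exact hfi.integrable_convolution (ContinuousLinearMap.mul ℂ ℂ) hgi
  · rw [← hkey, MeasureTheory.integral_convolution (ContinuousLinearMap.mul ℂ ℂ) hfi hgi,
      ContinuousLinearMap.mul_apply', hfe, hge]
    field_simp

end Literature.Analysis.TotalPositivity

end
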